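import Literature.Algebra.Polynomial.CircuitOptimalConstant

/-!
# Univariate trinomials `b₀ + b₁ x^{2m} + c x^k`: the one-dimensional circuit

[cite: IlimanDewolff2016, Theorem 3.8 (the case n = 1: a circuit on the line is a pair of even
vertices `0 < 2m` with one interior lattice point `k`), Corollary 4.1 / arXiv Cor. 18]
[cite: IlimanDewolff2016GP, Corollary 13 (f_gp = f* for a single circuit) / Corollary 17]
[cite: Reznick1989, §1 (agiforms; in one variable `λ₀ + λ₁ x^{2m} − x^k`)]

The simplest circuit lives on the real line: vertices `0` and `2m` (`m ≥ 1`) and an interior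
lattice point `0 < k < 2m`, with barycentric weights `λ₁ = k/(2m)`, `λ₀ = 1 − λ₁`.  The circuit
polynomial is the TRINOMIAL `p(x) = b₀ + b₁ x^{2m} + c x^k` (`b₀, b₁ > 0`), its circuit number is
`Θ = (b₀/λ₀)^{λ₀} (b₁/λ₁)^{λ₁}`, and the general theory of the companion files specialises to:

* `p ≥ 0 on ℝ ⟺ (c ≥ 0 ∧ k even) ∨ |c| ≤ Θ` (`trinomial_nonneg_iff`, from
  `CircuitNormMinimiser.circuitPolynomial_nonneg_iff'`);
* for a proper trinomial (`c ≠ 0`; `c < 0` or `k` odd) `min_ℝ p = b₀ (1 − (|c|/Θ)^{1/λ₀})`, attained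
  (`isLeast_trinomial`, from `CircuitOptimalConstant.isLeast_circuitPolynomial`).

Worked instances (`λ₀ = λ₁ = ½`, `Θ = 2 √(b₀ b₁)`): `1 + x⁴ + c x² ≥ 0 ⟺ c ≥ −2`
(`one_add_pow_four_add_mul_sq_nonneg_iff`), `1 + x⁶ + c x³ ≥ 0 ⟺ |c| ≤ 2`
(`one_add_pow_six_add_mul_cube_nonneg_iff`) and `min_ℝ (1 + x⁶ + c x³) = 1 − c²/4`
(`isLeast_one_add_pow_six_add_mul_cube`).

All statements are fully proved; no named facts are introduced.  The weights are taken as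
parameters `w₀, w₁ > 0`, `w₀ + w₁ = 1`, `k = w₁ · 2m`, so that instances come out with the weights
in lowest terms.
-/

namespace Literature.Algebra.Polynomial.CircuitTrinomial

open Finset Matrix Literature.Algebra.Polynomial.CircuitNumberNonnegativity
open Literature.Algebra.Polynomial.CircuitNormMinimiser
open Literature.Algebra.Polynomial.CircuitOptimalConstant

/-! ### The trinomial as a circuit polynomial in `Fin 1 → ℝ` -/

/-- Evaluation of the circuit form with outer exponents `(0), (2m)` and inner exponent `(k)` on
`ℝ^{Fin 1}` is the trinomial `b₀ + b₁ x₀^{2m} + c x₀^k`.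
[cite: IlimanDewolff2016, Theorem 3.8 (n = 1)] -/
theorem circuit_eval_eq_trinomial (b₀ b₁ c : ℝ) (m k : ℕ) (x : Fin 1 → ℝ) :
    ∑ j : Fin 2, (![b₀, b₁] : Fin 2 → ℝ) j
        * ∏ i : Fin 1, x i ^ (![fun _ => 0, fun _ => 2 * m] : Fin 2 → Fin 1 → ℕ) j i
      + c * ∏ i : Fin 1, x i ^ (fun _ : Fin 1 => k) i
      = b₀ + b₁ * x 0 ^ (2 * m) + c * x 0 ^ k := by
  simp [Fin.sum_univ_two]

/-- The circuit number of the trinomial configuration: `Θ = (b₀/λ₀)^{λ₀} (b₁/λ₁)^{λ₁}`.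
[cite: IlimanDewolff2016, Definition 3.1 / Theorem 3.8 (Θ_f for n = 1)] -/
theorem circuitNumber_two (b₀ b₁ w₀ w₁ : ℝ) :
    circuitNumber (![b₀, b₁] : Fin 2 → ℝ) ![w₀, w₁] = (b₀ / w₀) ^ w₀ * (b₁ / w₁) ^ w₁ := by
  simp [circuitNumber, Fin.prod_univ_two]

/-- The two vertices `0 ≠ 2m` of the segment are affinely independent (`m ≠ 0`).
[cite: IlimanDewolff2016, §2 (a circuit: affinely independent even vertices + interior point)] -/
theorem affineIndependent_two_vertices {m : ℕ} (hm : m ≠ 0) :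
    AffineIndependent ℝ (fun (j : Fin 2) (i : Fin 1) =>
      ((![fun _ => 0, fun _ => 2 * m] : Fin 2 → Fin 1 → ℕ) j i : ℝ)) := by
  have h : (fun (j : Fin 2) (i : Fin 1) =>
        ((![fun _ => 0, fun _ => 2 * m] : Fin 2 → Fin 1 → ℕ) j i : ℝ))
      = ![fun _ => (0 : ℝ), fun _ => 2 * (m : ℝ)] := by
    funext j i
    fin_cases j <;> simp
  rw [h]
  refine affineIndependent_of_ne ℝ ?_
  intro h0
  have h1 := congr_fun h0 0
  have hm' : (m : ℝ) ≠ 0 := by exact_mod_cast hm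
  exact hm' (by linarith)

/-! ### Nonnegativity and minimum of a trinomial -/

/-- **Nonnegativity of a trinomial** `p(x) = b₀ + b₁ x^{2m} + c x^k` (`b₀, b₁ > 0`, `m ≥ 1`,
`k = λ₁ · 2m` with weights `λ₀, λ₁ > 0`, `λ₀ + λ₁ = 1`, i.e. `0 < k < 2m`):
`p ≥ 0 on ℝ ⟺ (c ≥ 0 ∧ k even) ∨ |c| ≤ (b₀/λ₀)^{λ₀} (b₁/λ₁)^{λ₁}`.
[cite: IlimanDewolff2016, Theorem 3.8 (n = 1)] -/
theorem trinomial_nonneg_iff {b₀ b₁ w₀ w₁ : ℝ} (hb₀ : 0 < b₀) (hb₁ : 0 < b₁) (hw₀ : 0 < w₀)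
    (hw₁ : 0 < w₁) (hw : w₀ + w₁ = 1) {m k : ℕ} (hm : m ≠ 0) (hk : (k : ℝ) = w₁ * (2 * m))
    (c : ℝ) :
    (∀ x : ℝ, 0 ≤ b₀ + b₁ * x ^ (2 * m) + c * x ^ k) ↔
      (0 ≤ c ∧ Even k) ∨ |c| ≤ (b₀ / w₀) ^ w₀ * (b₁ / w₁) ^ w₁ := by
  have hb : ∀ j, 0 < (![b₀, b₁] : Fin 2 → ℝ) j := by
    intro j; fin_cases j <;> simpa
  have hwp : ∀ j, 0 < (![w₀, w₁] : Fin 2 → ℝ) j := by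
    intro j; fin_cases j <;> simpa
  have hw1 : ∑ j, (![w₀, w₁] : Fin 2 → ℝ) j = 1 := by
    simp [Fin.sum_univ_two, hw]
  have ha : ∀ j i, Even ((![fun _ => 0, fun _ => 2 * m] : Fin 2 → Fin 1 → ℕ) j i) := by
    intro j i; fin_cases j
    · exact ⟨0, rfl⟩
    · exact ⟨m, by simp [two_mul]⟩
  have hβ : ∀ i : Fin 1, (((fun _ : Fin 1 => k) i : ℕ) : ℝ)
      = ∑ j, (![w₀, w₁] : Fin 2 → ℝ) j
        * (((![fun _ => 0, fun _ => 2 * m] : Fin 2 → Fin 1 → ℕ) j i : ℕ) : ℝ) := by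
    intro i
    simp [Fin.sum_univ_two, hk]
  have key := circuitPolynomial_nonneg_iff' hb hwp hw1 ha (affineIndependent_two_vertices hm) hβ
    (c := c)
  simp_rw [circuit_eval_eq_trinomial] at key
  rw [circuitNumber_two] at key
  have hkey' : (∀ x : Fin 1 → ℝ, 0 ≤ b₀ + b₁ * x 0 ^ (2 * m) + c * x 0 ^ k) ↔
      ∀ x : ℝ, 0 ≤ b₀ + b₁ * x ^ (2 * m) + c * x ^ k :=
    ⟨fun h x => h fun _ => x, fun h x => h (x 0)⟩
  have heven : (∀ i : Fin 1, Even ((fun _ : Fin 1 => k) i)) ↔ Even k :=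
    ⟨fun h => h 0, fun h _ => h⟩
  rw [hkey', heven] at key
  exact key

/-- **Minimum of a proper trinomial in closed form**: for `c ≠ 0` with `c < 0` or `k` odd,
`min_ℝ (b₀ + b₁ x^{2m} + c x^k) = b₀ (1 − (|c|/Θ)^{1/λ₀})`, `Θ = (b₀/λ₀)^{λ₀} (b₁/λ₁)^{λ₁}`, and the
minimum is attained.
[cite: IlimanDewolff2016GP, Corollary 13 (f_gp = f* for a single circuit) and Corollary 17
(f_gp = f_0 − m*)] -/
theorem isLeast_trinomial {b₀ b₁ w₀ w₁ : ℝ} (hb₀ : 0 < b₀) (hb₁ : 0 < b₁) (hw₀ : 0 < w₀)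
    (hw₁ : 0 < w₁) (hw : w₀ + w₁ = 1) {m k : ℕ} (hm : m ≠ 0) (hk : (k : ℝ) = w₁ * (2 * m))
    {c : ℝ} (hc0 : c ≠ 0) (hprop : c < 0 ∨ Odd k) :
    IsLeast (Set.range fun x : ℝ => b₀ + b₁ * x ^ (2 * m) + c * x ^ k)
      (b₀ * (1 - (|c| / ((b₀ / w₀) ^ w₀ * (b₁ / w₁) ^ w₁)) ^ (1 / w₀))) := by
  have hb : ∀ j, 0 < (![b₀, b₁] : Fin 2 → ℝ) j := by
    intro j; fin_cases j <;> simpa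
  have hwp : ∀ j, 0 < (![w₀, w₁] : Fin 2 → ℝ) j := by
    intro j; fin_cases j <;> simpa
  have hw1 : ∑ j, (![w₀, w₁] : Fin 2 → ℝ) j = 1 := by
    simp [Fin.sum_univ_two, hw]
  have ha : ∀ j i, Even ((![fun _ => 0, fun _ => 2 * m] : Fin 2 → Fin 1 → ℕ) j i) := by
    intro j i; fin_cases j
    · exact ⟨0, rfl⟩
    · exact ⟨m, by simp [two_mul]⟩
  have hβ : ∀ i : Fin 1, (((fun _ : Fin 1 => k) i : ℕ) : ℝ)
      = ∑ j, (![w₀, w₁] : Fin 2 → ℝ) j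
        * (((![fun _ => 0, fun _ => 2 * m] : Fin 2 → Fin 1 → ℕ) j i : ℕ) : ℝ) := by
    intro i
    simp [Fin.sum_univ_two, hk]
  have hj₀ : ∀ i : Fin 1, (![fun _ => 0, fun _ => 2 * m] : Fin 2 → Fin 1 → ℕ) 0 i = 0 := by
    intro i; simp
  have hprop' : c < 0 ∨ ∃ i : Fin 1, Odd ((fun _ : Fin 1 => k) i) :=
    hprop.imp_right fun h => ⟨0, h⟩
  have key := isLeast_circuitPolynomial hb hwp hw1 ha (affineIndependent_two_vertices hm) hβ hj₀
    hc0 hprop'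
  simp_rw [circuit_eval_eq_trinomial] at key
  rw [circuitNumber_two] at key
  have hset : (Set.range fun x : Fin 1 → ℝ => b₀ + b₁ * x 0 ^ (2 * m) + c * x 0 ^ k)
      = Set.range fun x : ℝ => b₀ + b₁ * x ^ (2 * m) + c * x ^ k := by
    ext v
    constructor
    · rintro ⟨x, rfl⟩; exact ⟨x 0, rfl⟩
    · rintro ⟨x, rfl⟩; exact ⟨fun _ => x, rfl⟩
  rw [hset] at key
  simpa using key

/-! ### Worked instances with `λ₀ = λ₁ = ½` -/

/-- `Θ = 2` for `b₀ = b₁ = 1`, `λ₀ = λ₁ = ½` (`2^{1/2} · 2^{1/2} = 2`). [folklore] -/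
private theorem theta_half_half :
    ((1 : ℝ) / (1 / 2)) ^ ((1 : ℝ) / 2) * (1 / (1 / 2)) ^ ((1 : ℝ) / 2) = 2 := by
  rw [← Real.rpow_add (by norm_num : (0 : ℝ) < 1 / (1 / 2))]
  norm_num

/-- **The quartic `1 + x⁴ + c x²`** is nonnegative on `ℝ` iff `c ≥ −2` (inner exponent even:
`c ≥ 0` always works, and for `c < 0` the circuit condition `|c| ≤ Θ = 2` decides).
[cite: IlimanDewolff2016, Theorem 3.8 (n = 1, y = 2 ∈ 2ℕ)] -/
theorem one_add_pow_four_add_mul_sq_nonneg_iff (c : ℝ) :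
    (∀ x : ℝ, 0 ≤ 1 + x ^ 4 + c * x ^ 2) ↔ -2 ≤ c := by
  have h := trinomial_nonneg_iff one_pos one_pos (w₀ := 1 / 2) (w₁ := 1 / 2) (by norm_num)
    (by norm_num) (by norm_num) (m := 2) (k := 2) (by norm_num) (by norm_num) c
  rw [theta_half_half] at h
  have h4 : (∀ x : ℝ, 0 ≤ 1 + 1 * x ^ (2 * 2) + c * x ^ 2) ↔
      ∀ x : ℝ, 0 ≤ 1 + x ^ 4 + c * x ^ 2 := by
    refine forall_congr' fun x => ?_
    norm_num
  rw [h4] at h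
  rw [h, abs_le]
  have he : Even 2 := ⟨1, rfl⟩
  constructor
  · rintro (⟨hc, -⟩ | ⟨h1, -⟩) <;> linarith
  · intro hc
    by_cases hc0 : 0 ≤ c
    · exact Or.inl ⟨hc0, he⟩
    · exact Or.inr ⟨hc, by linarith⟩

/-- **The sextic `1 + x⁶ + c x³`** is nonnegative on `ℝ` iff `|c| ≤ 2` (inner exponent odd: the
two-sided circuit condition).
[cite: IlimanDewolff2016, Theorem 3.8 (n = 1, y = 3 ∉ 2ℕ)] -/
theorem one_add_pow_six_add_mul_cube_nonneg_iff (c : ℝ) :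
    (∀ x : ℝ, 0 ≤ 1 + x ^ 6 + c * x ^ 3) ↔ |c| ≤ 2 := by
  have h := trinomial_nonneg_iff one_pos one_pos (w₀ := 1 / 2) (w₁ := 1 / 2) (by norm_num)
    (by norm_num) (by norm_num) (m := 3) (k := 3) (by norm_num) (by norm_num) c
  rw [theta_half_half] at h
  have h6 : (∀ x : ℝ, 0 ≤ 1 + 1 * x ^ (2 * 3) + c * x ^ 3) ↔
      ∀ x : ℝ, 0 ≤ 1 + x ^ 6 + c * x ^ 3 := by
    refine forall_congr' fun x => ?_
    norm_num
  rw [h6] at h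
  rw [h]
  have hodd : ¬ Even 3 := by decide
  constructor
  · rintro (⟨-, he⟩ | h1)
    · exact absurd he hodd
    · exact h1
  · exact fun h1 => Or.inr h1

/-- **`min_ℝ (1 + x⁶ + c x³) = 1 − c²/4`**, attained (at `x³ = −c/2`): the closed-form
single-circuit minimum `b₀(1 − (|c|/Θ)^{1/λ₀})` with `b₀ = 1`, `Θ = 2`, `λ₀ = ½`.  (For `c = 0`
directly.)
[cite: IlimanDewolff2016GP, Corollary 13 / Corollary 17 (f_gp = f_0 − m* = f*)] -/
theorem isLeast_one_add_pow_six_add_mul_cube (c : ℝ) :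
    IsLeast (Set.range fun x : ℝ => 1 + x ^ 6 + c * x ^ 3) (1 - c ^ 2 / 4) := by
  by_cases hc0 : c = 0
  · subst hc0
    refine ⟨⟨0, by norm_num⟩, ?_⟩
    rintro _ ⟨x, rfl⟩
    have : 0 ≤ x ^ 6 := by positivity
    norm_num
    linarith
  have h := isLeast_trinomial one_pos one_pos (w₀ := 1 / 2) (w₁ := 1 / 2) (by norm_num)
    (by norm_num) (by norm_num) (m := 3) (k := 3) (by norm_num) (by norm_num) hc0
    (Or.inr ⟨1, rfl⟩)
  rw [theta_half_half] at h
  have hv : (1 : ℝ) * (1 - (|c| / 2) ^ ((1 : ℝ) / (1 / 2))) = 1 - c ^ 2 / 4 := by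
    have h2 : ((1 : ℝ) / (1 / 2)) = (2 : ℕ) := by norm_num
    rw [h2, Real.rpow_natCast, div_pow, sq_abs]
    ring
  rw [hv] at h
  have hset : (Set.range fun x : ℝ => 1 + 1 * x ^ (2 * 3) + c * x ^ 3)
      = Set.range fun x : ℝ => 1 + x ^ 6 + c * x ^ 3 := by
    refine congrArg Set.range (funext fun x => ?_)
    norm_num
  rw [hset] at h
  exact h

end Literature.Algebra.Polynomial.CircuitTrinomial
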